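import Literature.AlgebraicGeometry.Resolution.AlterationsLemma411VertexClosed
import Literature.AlgebraicGeometry.Resolution.PointBlowupAlgebraCharts
import Literature.AlgebraicGeometry.Resolution.BlowupStrictTransform
import Literature.AlgebraicGeometry.Motives.ProjBasicOpenSubscheme
import Literature.AlgebraicGeometry.Motives.VarietiesProjectiveSpaceProofs
import HarnessLib

/-!
# The blow-up of `ℙ^{d+1}` in the vertex: the charts over `D₊(x_{d+1})`

Topic: `Literature/AlgebraicGeometry/Resolution`. Scheme-level bookkeeping for the construction of
de Jong 1996, proof of Lemma 4.11 (p. 68) — the blowing up `b : P̃ → ℙ^{d+1}_k` of projective space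
in the vertex `p = (0 : … : 0 : 1)` (`DeJong1996.vertex`, `AlterationsLemma411Vertex.lean`), for
the named fact `DeJong1996VertexBlowupProjection`. For ANY blowing up `b` of `ℙ^{d+1}_k` along the
ideal sheaf of the reduced point `p` (`IsBlowup`, `Blowups.lean`), the part of `P̃` over the last
chart `D₊(x_{d+1}) = Spec k[X₀, …, X_d] = 𝔸^{d+1}` (`Xᵢ = xᵢ/x_{d+1}`; the vertex is the origin)
is covered by the `d + 1` principal charts `P̃[D₊(x_{d+1}), Xᵢ]` (Stacks, Tag 0804), and each of
them is the spectrum of the affine blowup algebra `Cᵢ = k[X][I/Xᵢ] = k[X_j/Xᵢ : j ≠ i][Xᵢ]` of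
`PointBlowupAlgebraCharts.lean`. PROVED here:

* `DeJong1996.lastChart d k` — `D₊(x_{d+1})` as an affine open of `ℙ^{d+1}_k`, and
  `DeJong1996.lastChartEquiv d k : Γ(ℙ^{d+1}, D₊(x_{d+1})) ≅ k[X₀, …, X_d]` (Mathlib's
  `Proj.basicOpenIsoAway` followed by the dehomogenisation isomorphism
  `Motives.ProjectiveSpace.chartAlgEquiv`), with `lastChartEquiv (xᵢ/x_{d+1}) = Xᵢ`;
* `DeJong1996.map_vanishingIdeal_vertex_ideal_lastChart` — **the ideal of the vertex on the chart
  is the ideal of the origin**: the sections over `D₊(x_{d+1})` of the vanishing ideal sheaf of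
  `{p}` correspond to `(X₀, …, X_d)` (`PointBlowup.originIdeal`); proof: `{p} = ⋂ᵢ V₊(xᵢ)`
  (maximality of `(x₀, …, x_d)` among points of `ℙ^{d+1}`, `eq_vertex_of_vertexIdeal_le`), the
  preimage of `V₊(xᵢ)` in `Spec (k[x]_{(x_{d+1})})₀` is `V(xᵢ/x_{d+1})`
  (`ProjSubscheme.awayι_preimage_zeroLocus`), and `(X₀, …, X_d)` is prime, hence radical;
* `DeJong1996.vertexSection d k i ∈ I(D₊(x_{d+1}))` — the sections `xᵢ/x_{d+1}`, which generate;
* for a blowing up `b : P̃ → ℙ^{d+1}_k` in the vertex (`hb : IsBlowup b I`):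
  `DeJong1996.vertexChart hb i : Spec Cᵢ → P̃` — an OPEN IMMERSION onto the principal chart
  `P̃[D₊(x_{d+1}), xᵢ/x_{d+1}]` (`opensRange_vertexChart`), lying over
  `Spec Cᵢ → Spec k[X] = D₊(x_{d+1}) ⊆ ℙ^{d+1}` (`vertexChart_comp`); obtained from the chart
  `Spec Γ(D₊(x_{d+1}))[I/(xᵢ/x_{d+1})] → P̃` of `BlowupStrictTransform.lean`
  (`IsBlowup.exists_blowupAlgebra_chart_opensRange_eq`) by transporting the affine blowup algebra
  along `lastChartEquiv` (`blowupAlgebra.congrEquiv`);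
* `DeJong1996.iSup_opensRange_vertexChart` — these charts cover `b⁻¹ D₊(x_{d+1})`
  (`IsBlowup.iSup_blowupChart`), and `DeJong1996.preimage_puncturedSpace_sup_iSup` — together
  with `b⁻¹(ℙ^{d+1} ∖ {vertex}) = ⋃_{i ≤ d} b⁻¹ D₊(xᵢ)` they cover `P̃`.

No new named facts; the one definition with content is the chart morphism (a choice from an
existence statement), the rest are abbreviations.

## Sources

* A. J. de Jong, *Smoothness, semi-stability and alterations*, Publ. Math. IHÉS 83 (1996),
  proof of Lemma 4.11, p. 68. [DeJong1996]
* The Stacks Project, Tag 0804 (charts `Spec A[I/a]` of a blowing up). [StacksProject]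
* R. Hartshorne, *Algebraic Geometry* (1977), II Prop. 2.5 (b) (`D₊(f) = Spec A_{(f)}`).
  [Hartshorne1977]
-/

noncomputable section

open CategoryTheory CategoryTheory.Limits AlgebraicGeometry TopologicalSpace HomogeneousLocalization

attribute [local instance] MvPolynomial.gradedAlgebra
  Literature.AlgebraicGeometry.Motives.ProjBaseChange.algebraBase
  Literature.AlgebraicGeometry.Motives.ProjBaseChange.isScalarTower_localization

namespace Literature.AlgebraicGeometry.Resolution

universe u

open Literature.AlgebraicGeometry.Motives (projectiveSpace)
open Literature.AlgebraicGeometry.Motives.Segre (grading chartι toSpec X_mem)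

namespace DeJong1996

variable (d : ℕ) (k : Type u) [Field k]

/-! ## The last chart `D₊(x_{d+1}) = Spec k[X₀, …, X_d]` of `ℙ^{d+1}_k` -/

/-- The affine open `D₊(x_{d+1}) ⊆ ℙ^{d+1}_k`, the chart containing the vertex.
[cite: Hartshorne1977, II Prop. 2.5 (b)] -/
abbrev lastChart : (Proj (grading (Fin (d + 1 + 1)) k)).affineOpens :=
  Motives.ProjSubscheme.affineBasicOpen (grading (Fin (d + 1 + 1)) k)
    (MvPolynomial.X (Fin.last (d + 1))) (X_mem k (Fin.last (d + 1))) zero_lt_one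

/-- The vertex lies in the last chart. [folklore] -/
theorem vertex_mem_lastChart : vertex d k ∈ (lastChart d k : (Proj (grading (Fin (d + 1 + 1)) k)).Opens) :=
  vertex_mem_basicOpen_last d k

/-- **The coordinate ring of the last chart**: `Γ(ℙ^{d+1}, D₊(x_{d+1})) ≅ k[X₀, …, X_d]`, the
section isomorphism `(k[x]_{(x_{d+1})})₀ ≅ Γ(D₊(x_{d+1}))` (Mathlib) reversed and followed by the
dehomogenisation `(k[x]_{(x_{d+1})})₀ ≅ k[X₀, …, X_d]`, `xᵢ/x_{d+1} ↦ Xᵢ`.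
[cite: Hartshorne1977, II Prop. 2.5 (b)] -/
def lastChartEquiv :
    Γ(Proj (grading (Fin (d + 1 + 1)) k), (lastChart d k : (Proj (grading (Fin (d + 1 + 1)) k)).Opens)) ≃+*
      MvPolynomial (Fin (d + 1)) k :=
  (Proj.basicOpenIsoAway (grading (Fin (d + 1 + 1)) k) (MvPolynomial.X (Fin.last (d + 1)))
      (X_mem k (Fin.last (d + 1))) zero_lt_one).commRingCatIsoToRingEquiv.symm.trans
    (Motives.ProjectiveSpace.chartAlgEquiv k (Fin.last (d + 1))).toRingEquiv

/-- `lastChartEquiv` after the section map `(k[x]_{(x_{d+1})})₀ → Γ(D₊(x_{d+1}))` is the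
dehomogenisation isomorphism. [folklore] -/
theorem lastChartEquiv_awayToSection (a : Away (grading (Fin (d + 1 + 1)) k) (MvPolynomial.X (Fin.last (d + 1)))) :
    lastChartEquiv d k (Proj.awayToSection (grading (Fin (d + 1 + 1)) k) (MvPolynomial.X (Fin.last (d + 1))) a) =
      Motives.ProjectiveSpace.chartAlgEquiv k (Fin.last (d + 1)) a := by
  simp only [lastChartEquiv, RingEquiv.trans_apply, AlgEquiv.coe_ringEquiv]
  congr 1
  apply (Proj.basicOpenIsoAway (grading (Fin (d + 1 + 1)) k) (MvPolynomial.X (Fin.last (d + 1)))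
      (X_mem k (Fin.last (d + 1))) zero_lt_one).commRingCatIsoToRingEquiv.injective
  rw [RingEquiv.apply_symm_apply]
  rfl

/-- The section `xᵢ/x_{d+1} ∈ Γ(ℙ^{d+1}, D₊(x_{d+1}))`, `i ≤ d` — the `i`-th coordinate of the
chart, vanishing at the vertex. [folklore] -/
def vertexSection (i : Fin (d + 1)) :
    Γ(Proj (grading (Fin (d + 1 + 1)) k), (lastChart d k : (Proj (grading (Fin (d + 1 + 1)) k)).Opens)) :=
  (lastChartEquiv d k).symm (MvPolynomial.X i)

/-- `lastChartEquiv (xᵢ/x_{d+1}) = Xᵢ`. [folklore] -/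
@[simp]
theorem lastChartEquiv_vertexSection (i : Fin (d + 1)) :
    lastChartEquiv d k (vertexSection d k i) = MvPolynomial.X i :=
  (lastChartEquiv d k).apply_symm_apply _

/-- The dehomogenisation isomorphism sends `xᵢ/x_{d+1}` to `Xᵢ`. [folklore] -/
theorem chartAlgEquiv_chartGen (i : Fin (d + 1)) :
    Motives.ProjectiveSpace.chartAlgEquiv k (Fin.last (d + 1))
        (Motives.ProjectiveSpace.chartGen k (Fin.last (d + 1)) i) = MvPolynomial.X i := by
  rw [← Motives.ProjectiveSpace.chartAlgEquiv_symm_X, AlgEquiv.apply_symm_apply]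

/-- `xᵢ/x_{d+1}` is the section of the degree-zero fraction `chartGen`. [folklore] -/
theorem vertexSection_eq (i : Fin (d + 1)) :
    vertexSection d k i = Proj.awayToSection (grading (Fin (d + 1 + 1)) k) (MvPolynomial.X (Fin.last (d + 1)))
      (Motives.ProjectiveSpace.chartGen k (Fin.last (d + 1)) i) := by
  apply (lastChartEquiv d k).injective
  rw [lastChartEquiv_vertexSection, lastChartEquiv_awayToSection, chartAlgEquiv_chartGen]

/-! ## The ideal of the vertex on the last chart is the ideal of the origin -/

/-- The ideal sheaf of the vertex (reduced closed point). [cite: DeJong1996, Lemma 4.11 (proof), p. 68] -/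
abbrev vertexIdealSheaf : (Proj (grading (Fin (d + 1 + 1)) k)).IdealSheafData :=
  Scheme.IdealSheafData.vanishingIdeal ⟨{vertex d k}, isClosed_singleton_vertex d k⟩

/-- **A point of `ℙ^{d+1}_k` is the vertex iff all `xᵢ`, `i ≤ d`, vanish at it** (maximality of
`(x₀, …, x_d)`, `eq_vertex_of_vertexIdeal_le`). [folklore] -/
theorem eq_vertex_iff (x : Proj (grading (Fin (d + 1 + 1)) k)) :
    x = vertex d k ↔ ∀ i : Fin (d + 1),
      (MvPolynomial.X (Fin.castSucc i) : MvPolynomial (Fin (d + 1 + 1)) k) ∈ x.asHomogeneousIdeal := by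
  constructor
  · rintro rfl i
    exact X_castSucc_mem_vertexIdeal d k i
  · intro h
    refine eq_vertex_of_vertexIdeal_le d k x ?_
    change (vertexIdeal d k).toIdeal ≤ x.asHomogeneousIdeal.toIdeal
    rw [toIdeal_vertexIdeal, Ideal.span_le]
    rintro _ ⟨_, ⟨i, rfl⟩, rfl⟩
    exact h i

/-- The degree-zero fraction `xᵢ/x_{d+1}` in Mathlib's spelling `isLocalizationElem` is
`chartGen`. [folklore] -/
theorem isLocalizationElem_eq_chartGen (i : Fin (d + 1)) :
    Away.isLocalizationElem (X_mem k (Fin.last (d + 1))) (X_mem k (Fin.castSucc i)) =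
      Motives.ProjectiveSpace.chartGen k (Fin.last (d + 1)) i := by
  apply HomogeneousLocalization.val_injective
  simp only [Away.isLocalizationElem, Away.val_mk, Motives.ProjectiveSpace.val_chartGen, pow_one,
    Fin.succAbove_last]

/-- A point `p` of `Spec (k[x]_{(x_{d+1})})₀` lies over `V₊(xᵢ)` iff `xᵢ/x_{d+1} ∈ p`
(`ProjSubscheme.awayι_preimage_zeroLocus`, pointwise). [folklore] -/
theorem X_castSucc_mem_awayι_iff (i : Fin (d + 1))
    (p : Spec (.of (Away (grading (Fin (d + 1 + 1)) k) (MvPolynomial.X (Fin.last (d + 1)))))) :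
    (MvPolynomial.X (Fin.castSucc i) : MvPolynomial (Fin (d + 1 + 1)) k) ∈
        (Proj.awayι (grading (Fin (d + 1 + 1)) k) (MvPolynomial.X (Fin.last (d + 1)))
          (X_mem k (Fin.last (d + 1))) zero_lt_one p).asHomogeneousIdeal ↔
      Motives.ProjectiveSpace.chartGen k (Fin.last (d + 1)) i ∈ p.asIdeal := by
  have h := Set.ext_iff.mp (Motives.ProjSubscheme.awayι_preimage_zeroLocus (grading (Fin (d + 1 + 1)) k)
    (X_mem k (Fin.last (d + 1))) zero_lt_one (X_mem k (Fin.castSucc i)) zero_lt_one) p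
  rw [isLocalizationElem_eq_chartGen] at h
  have h' : (({MvPolynomial.X (Fin.castSucc i)} : Set (MvPolynomial (Fin (d + 1 + 1)) k)) ⊆
      ((Proj.awayι (grading (Fin (d + 1 + 1)) k) (MvPolynomial.X (Fin.last (d + 1)))
          (X_mem k (Fin.last (d + 1))) zero_lt_one p).asHomogeneousIdeal : Set _)) ↔
      (({Motives.ProjectiveSpace.chartGen k (Fin.last (d + 1)) i} : Set _) ⊆ (p.asIdeal : Set _)) := h
  rw [Set.singleton_subset_iff, Set.singleton_subset_iff, SetLike.mem_coe, SetLike.mem_coe] at h'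
  exact h'

/-- **The preimage of the vertex in `Spec (k[x]_{(x_{d+1})})₀` is `V(x₀/x_{d+1}, …, x_d/x_{d+1})`.**
[folklore] -/
theorem awayι_preimage_singleton_vertex :
    (Proj.awayι (grading (Fin (d + 1 + 1)) k) (MvPolynomial.X (Fin.last (d + 1)))
        (X_mem k (Fin.last (d + 1))) zero_lt_one) ⁻¹' {vertex d k} =
      PrimeSpectrum.zeroLocus (Set.range fun i : Fin (d + 1) =>
        Motives.ProjectiveSpace.chartGen k (Fin.last (d + 1)) i) := by
  ext p
  rw [Set.mem_preimage, Set.mem_singleton_iff, eq_vertex_iff]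
  constructor
  · rintro h _ ⟨i, rfl⟩
    exact (X_castSucc_mem_awayι_iff d k i p).mp (h i)
  · intro h i
    exact (X_castSucc_mem_awayι_iff d k i p).mpr (h ⟨i, rfl⟩)

/-- The ideal `(x₀/x_{d+1}, …, x_d/x_{d+1})` of `(k[x]_{(x_{d+1})})₀` corresponds to the ideal of
the origin under dehomogenisation. [folklore] -/
theorem map_span_chartGen :
    (Ideal.span (Set.range fun i : Fin (d + 1) =>
        Motives.ProjectiveSpace.chartGen k (Fin.last (d + 1)) i)).map
      (Motives.ProjectiveSpace.chartAlgEquiv k (Fin.last (d + 1))).toRingEquiv.toRingHom =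
      PointBlowup.originIdeal d k := by
  rw [Ideal.map_span]
  apply le_antisymm
  · rw [Ideal.span_le]
    rintro _ ⟨_, ⟨i, rfl⟩, rfl⟩
    have : (Motives.ProjectiveSpace.chartAlgEquiv k (Fin.last (d + 1))).toRingEquiv.toRingHom
        (Motives.ProjectiveSpace.chartGen k (Fin.last (d + 1)) i) = MvPolynomial.X i :=
      chartAlgEquiv_chartGen d k i
    rw [SetLike.mem_coe, this]
    exact Ideal.subset_span (Set.mem_range_self i)
  · rw [Ideal.span_le]
    rintro _ ⟨i, rfl⟩
    exact Ideal.subset_span ⟨Motives.ProjectiveSpace.chartGen k (Fin.last (d + 1)) i,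
      Set.mem_range_self i, chartAlgEquiv_chartGen d k i⟩

/-- The ideal of the origin `(X₀, …, X_d) ⊂ k[X]` is prime (its quotient is `k`). [folklore] -/
theorem isPrime_originIdeal : (PointBlowup.originIdeal d k).IsPrime := by
  have h : IsDomain (MvPolynomial (Fin (d + 1)) k ⧸
      Ideal.span (MvPolynomial.X '' (Set.univ : Set (Fin (d + 1))) : Set (MvPolynomial (Fin (d + 1)) k))) :=
    MvPolynomial.isDomain_quotient_span_X (R := k) _
  rw [Set.image_univ] at h
  exact (Ideal.Quotient.isDomain_iff_prime _).mp h

/-- The ideal `(x₀/x_{d+1}, …, x_d/x_{d+1})` is the pull-back of the ideal of the origin under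
dehomogenisation. [folklore] -/
theorem span_chartGen_eq_comap :
    Ideal.span (Set.range fun i : Fin (d + 1) =>
        Motives.ProjectiveSpace.chartGen k (Fin.last (d + 1)) i) =
      (PointBlowup.originIdeal d k).comap
        (Motives.ProjectiveSpace.chartAlgEquiv k (Fin.last (d + 1))).toRingEquiv.toRingHom := by
  rw [← map_span_chartGen, Ideal.comap_map_of_bijective
    (Motives.ProjectiveSpace.chartAlgEquiv k (Fin.last (d + 1))).toRingEquiv.toRingHom
    ((Motives.ProjectiveSpace.chartAlgEquiv k (Fin.last (d + 1))).toRingEquiv.bijective :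
      Function.Bijective (Motives.ProjectiveSpace.chartAlgEquiv k (Fin.last (d + 1))).toRingEquiv.toRingHom)]

/-- The ideal `(x₀/x_{d+1}, …, x_d/x_{d+1})` is prime. [folklore] -/
theorem isPrime_span_chartGen :
    (Ideal.span (Set.range fun i : Fin (d + 1) =>
        Motives.ProjectiveSpace.chartGen k (Fin.last (d + 1)) i)).IsPrime := by
  rw [span_chartGen_eq_comap]
  haveI := isPrime_originIdeal d k
  exact Ideal.comap_isPrime _ _

/-- **The ideal of the vertex on the last chart**: the sections over `D₊(x_{d+1})` of the
vanishing ideal sheaf of `{vertex}` are carried by `lastChartEquiv` onto the ideal of the origin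
`(X₀, …, X_d) ⊂ k[X₀, …, X_d]`. [cite: DeJong1996, Lemma 4.11 (proof), p. 68] -/
theorem map_vanishingIdeal_vertex_ideal_lastChart :
    ((vertexIdealSheaf d k).ideal (lastChart d k)).map (lastChartEquiv d k).toRingHom =
      PointBlowup.originIdeal d k := by
  have h1 : (vertexIdealSheaf d k).ideal (lastChart d k) =
      Ideal.map (Proj.awayToSection (grading (Fin (d + 1 + 1)) k) (MvPolynomial.X (Fin.last (d + 1)))).hom
        (Ideal.span (Set.range fun i : Fin (d + 1) =>
          Motives.ProjectiveSpace.chartGen k (Fin.last (d + 1)) i)) := by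
    have h := Motives.ProjSubscheme.vanishingIdeal_ideal_affineBasicOpen (grading (Fin (d + 1 + 1)) k)
      (MvPolynomial.X (Fin.last (d + 1))) (X_mem k (Fin.last (d + 1))) zero_lt_one
      ⟨{vertex d k}, isClosed_singleton_vertex d k⟩
    have h2 : PrimeSpectrum.vanishingIdeal
        ((Proj.awayι (grading (Fin (d + 1 + 1)) k) (MvPolynomial.X (Fin.last (d + 1)))
          (X_mem k (Fin.last (d + 1))) zero_lt_one) ⁻¹' {vertex d k}) =
        Ideal.span (Set.range fun i : Fin (d + 1) =>
          Motives.ProjectiveSpace.chartGen k (Fin.last (d + 1)) i) :=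
      (congrArg (PrimeSpectrum.vanishingIdeal (R := Away (grading (Fin (d + 1 + 1)) k)
        (MvPolynomial.X (Fin.last (d + 1))))) (awayι_preimage_singleton_vertex d k)).trans (by
          rw [← PrimeSpectrum.zeroLocus_span, PrimeSpectrum.vanishingIdeal_zeroLocus_eq_radical,
            Ideal.IsPrime.radical (isPrime_span_chartGen d k)])
    exact h.trans (congrArg _ h2)
  rw [h1, Ideal.map_map, ← map_span_chartGen]
  congr 1
  exact RingHom.ext fun a => lastChartEquiv_awayToSection d k a

/-- The ideal of the vertex on the chart is the pull-back of the ideal of the origin. [folklore] -/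
theorem vanishingIdeal_vertex_ideal_lastChart_eq_comap :
    (vertexIdealSheaf d k).ideal (lastChart d k) =
      (PointBlowup.originIdeal d k).comap (lastChartEquiv d k).toRingHom := by
  rw [← map_vanishingIdeal_vertex_ideal_lastChart, Ideal.comap_map_of_bijective
    (lastChartEquiv d k).toRingHom
    ((lastChartEquiv d k).bijective : Function.Bijective (lastChartEquiv d k).toRingHom)]

/-- `Ideal.span` of the coordinate sections is the ideal of the vertex on the chart. [folklore] -/
theorem span_range_vertexSection :
    Ideal.span (Set.range (vertexSection d k)) = (vertexIdealSheaf d k).ideal (lastChart d k) := by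
  have hmap : (Ideal.span (Set.range (vertexSection d k))).map (lastChartEquiv d k).toRingHom =
      PointBlowup.originIdeal d k := by
    rw [Ideal.map_span, ← Set.range_comp]
    have : (⇑(lastChartEquiv d k).toRingHom ∘ vertexSection d k) = MvPolynomial.X :=
      funext fun i => lastChartEquiv_vertexSection d k i
    rw [this]
  rw [vanishingIdeal_vertex_ideal_lastChart_eq_comap, ← hmap,
    Ideal.comap_map_of_bijective (lastChartEquiv d k).toRingHom
      ((lastChartEquiv d k).bijective : Function.Bijective (lastChartEquiv d k).toRingHom)]

/-- The coordinate sections lie in the ideal of the vertex. [folklore] -/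
theorem vertexSection_mem (i : Fin (d + 1)) :
    vertexSection d k i ∈ (vertexIdealSheaf d k).ideal (lastChart d k) := by
  rw [← span_range_vertexSection]
  exact Ideal.subset_span (Set.mem_range_self i)


/-! ## The whole of `ℙ^{d+1}`: punctured space and last chart -/

/-- `ℙ^{d+1} = (ℙ^{d+1} ∖ {vertex}) ∪ D₊(x_{d+1})`: every point lies in some `D₊(x_j)`.
[folklore] -/
theorem puncturedSpace_sup_lastChart :
    puncturedSpace d k ⊔ (lastChart d k : (Proj (grading (Fin (d + 1 + 1)) k)).Opens) = ⊤ := by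
  apply top_le_iff.mp
  intro x _
  by_cases hx : x = vertex d k
  · subst hx
    exact Opens.mem_sup.mpr (Or.inr (vertex_mem_lastChart d k))
  · exact Opens.mem_sup.mpr (Or.inl ((mem_puncturedSpace_iff d k x).mpr hx))

/-! ## The principal charts over `D₊(x_{d+1})` as spectra of the `Cᵢ = k[X][I/Xᵢ]` -/

section Charts

variable {d k}

/-- The ring map `Γ(ℙ^{d+1}, D₊(x_{d+1})) ≅ k[X₀, …, X_d] → Cᵢ = k[X][I/Xᵢ]` — the structure map
of the `i`-th chart over the last chart of `ℙ^{d+1}`. [cite: StacksProject, Tag 0804] -/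
def toChart (d : ℕ) (k : Type u) [Field k] (i : Fin (d + 1)) :
    Γ(Proj (grading (Fin (d + 1 + 1)) k), (lastChart d k : (Proj (grading (Fin (d + 1 + 1)) k)).Opens)) →+*
      PointBlowup.Chart d k i :=
  (algebraMap (MvPolynomial (Fin (d + 1)) k) (PointBlowup.Chart d k i)).comp (lastChartEquiv d k).toRingHom

/-- `toChart` on the coordinate sections: `xⱼ/x_{d+1} ↦ Xⱼ = Xᵢ · (Xⱼ/Xᵢ)`. [folklore] -/
theorem toChart_vertexSection (i j : Fin (d + 1)) :
    toChart d k i (vertexSection d k j) = PointBlowup.exc d k i * PointBlowup.frac d k i j := by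
  rw [toChart, RingHom.comp_apply, RingEquiv.toRingHom_eq_coe, RingEquiv.coe_toRingHom,
    lastChartEquiv_vertexSection, PointBlowup.algebraMap_X]

/-- **Transport of a chart of a blowing up along a ring isomorphism of the base chart** (the
general bookkeeping step): if `e : Γ(X, U) ≅ A'` carries `I(U)` to `J` and `a₀ ∈ I(U)` to `a`,
the chart `Spec Γ(X, U)[I(U)/a₀] → X'` of `BlowupStrictTransform.lean` becomes an open immersion
`Spec A'[J/a] → X'` onto the principal chart `X'[U, a₀]`, over `Spec A' ≅ Spec Γ(X, U) → X`.
[cite: StacksProject, Tag 0804] -/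
theorem _root_.Literature.AlgebraicGeometry.Resolution.IsBlowup.exists_chart_of_ringEquiv
    {X' X : Scheme.{u}} {π : X' ⟶ X} {I : X.IdealSheafData} (hπ : IsBlowup π I)
    (U : X.affineOpens) {a₀ : Γ(X, U)} (ha₀ : a₀ ∈ I.ideal U) {A' : Type u} [CommRing A']
    (e : Γ(X, U) ≃+* A') (J : Ideal A') (a : A') (hJ : (I.ideal U).map e.toRingHom = J)
    (ha : e a₀ = a) :
    ∃ (c : Spec (.of (blowupAlgebra J a)) ⟶ X') (_ : IsOpenImmersion c),
      c.opensRange = blowupChart π I U a₀ ∧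
        c ≫ π = Spec.map (CommRingCat.ofHom ((algebraMap A' (blowupAlgebra J a)).comp e.toRingHom)) ≫
          U.2.fromSpec := by
  subst hJ
  subst ha
  obtain ⟨g, hg, hrange, hcomp⟩ := hπ.exists_blowupAlgebra_chart_opensRange_eq U a₀ ha₀
  let ε := blowupAlgebra.congrEquiv e (I.ideal U) a₀
  have key : CommRingCat.ofHom (algebraMap Γ(X, U) (blowupAlgebra (I.ideal U) a₀)) ≫ ε.toCommRingCatIso.hom =
      CommRingCat.ofHom ((algebraMap A' (blowupAlgebra ((I.ideal U).map e.toRingHom) (e a₀))).comp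
        e.toRingHom) := by
    refine CommRingCat.hom_ext (RingHom.ext fun r => ?_)
    simp only [CommRingCat.hom_comp, CommRingCat.hom_ofHom, RingHom.comp_apply,
      RingEquiv.toCommRingCatIso_hom]
    exact blowupAlgebra.congrEquiv_algebraMap e (I.ideal U) a₀ r
  refine ⟨Spec.map ε.toCommRingCatIso.hom ≫ g, inferInstance, ?_, ?_⟩
  · rw [Scheme.Hom.opensRange_comp_of_isIso, hrange]
  · rw [Category.assoc, hcomp, ← Spec.map_comp_assoc, key]

variable {P : Scheme.{u}} {b : P ⟶ Proj (grading (Fin (d + 1 + 1)) k)}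

/-- For a blowing up `b : P̃ → ℙ^{d+1}_k` in the vertex: the existence of the `i`-th chart
`Spec Cᵢ → P̃` over `D₊(x_{d+1})`. [cite: StacksProject, Tag 0804] -/
theorem exists_vertexChart (hb : IsBlowup b (vertexIdealSheaf d k)) (i : Fin (d + 1)) :
    ∃ (c : Spec (.of (PointBlowup.Chart d k i)) ⟶ P) (_ : IsOpenImmersion c),
      c.opensRange = blowupChart b (vertexIdealSheaf d k) (lastChart d k) (vertexSection d k i) ∧
        c ≫ b = Spec.map (CommRingCat.ofHom (toChart d k i)) ≫ (lastChart d k).2.fromSpec :=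
  hb.exists_chart_of_ringEquiv (lastChart d k) (vertexSection_mem d k i) (lastChartEquiv d k)
    (PointBlowup.originIdeal d k) (MvPolynomial.X i) (map_vanishingIdeal_vertex_ideal_lastChart d k)
    (lastChartEquiv_vertexSection d k i)

/-- **The `i`-th chart `Spec Cᵢ → P̃` of a blowing up of `ℙ^{d+1}_k` in the vertex**,
`Cᵢ = k[X₀, …, X_d][I/Xᵢ]` (a choice of the open immersion onto the principal chart
`P̃[D₊(x_{d+1}), xᵢ/x_{d+1}]`, Stacks 0804). [cite: StacksProject, Tag 0804] -/
def vertexChart (hb : IsBlowup b (vertexIdealSheaf d k)) (i : Fin (d + 1)) :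
    Spec (.of (PointBlowup.Chart d k i)) ⟶ P :=
  (exists_vertexChart hb i).choose

/-- The chart is an open immersion. [cite: StacksProject, Tag 0804] -/
instance isOpenImmersion_vertexChart (hb : IsBlowup b (vertexIdealSheaf d k)) (i : Fin (d + 1)) :
    IsOpenImmersion (vertexChart hb i) :=
  (exists_vertexChart hb i).choose_spec.choose

/-- The image of the chart is the principal chart `P̃[D₊(x_{d+1}), xᵢ/x_{d+1}]`.
[cite: StacksProject, Tag 0804] -/
theorem opensRange_vertexChart (hb : IsBlowup b (vertexIdealSheaf d k)) (i : Fin (d + 1)) :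
    (vertexChart hb i).opensRange =
      blowupChart b (vertexIdealSheaf d k) (lastChart d k) (vertexSection d k i) :=
  (exists_vertexChart hb i).choose_spec.choose_spec.1

/-- The chart lies over `Spec Cᵢ → Spec k[X] = D₊(x_{d+1}) ⊆ ℙ^{d+1}`.
[cite: StacksProject, Tag 0804] -/
@[reassoc]
theorem vertexChart_comp (hb : IsBlowup b (vertexIdealSheaf d k)) (i : Fin (d + 1)) :
    vertexChart hb i ≫ b = Spec.map (CommRingCat.ofHom (toChart d k i)) ≫ (lastChart d k).2.fromSpec :=
  (exists_vertexChart hb i).choose_spec.choose_spec.2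

/-- The chart maps into `b⁻¹ D₊(x_{d+1})`. [folklore] -/
theorem opensRange_vertexChart_le (hb : IsBlowup b (vertexIdealSheaf d k)) (i : Fin (d + 1)) :
    (vertexChart hb i).opensRange ≤ b ⁻¹ᵁ (lastChart d k : (Proj (grading (Fin (d + 1 + 1)) k)).Opens) := by
  rw [opensRange_vertexChart]
  exact blowupChart_le_preimage b (vertexIdealSheaf d k) (lastChart d k) (vertexSection d k i)

/-- **The charts cover `b⁻¹ D₊(x_{d+1})`** (the `xᵢ/x_{d+1}` generate the ideal of the vertex
there; `IsBlowup.iSup_blowupChart`). [cite: StacksProject, Tag 0804] -/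
theorem iSup_opensRange_vertexChart (hb : IsBlowup b (vertexIdealSheaf d k)) :
    ⨆ i, (vertexChart hb i).opensRange =
      b ⁻¹ᵁ (lastChart d k : (Proj (grading (Fin (d + 1 + 1)) k)).Opens) := by
  simp_rw [opensRange_vertexChart]
  exact hb.iSup_blowupChart (vertexSection d k) (span_range_vertexSection d k)

/-- **`P̃` is covered by `b⁻¹(ℙ^{d+1} ∖ {vertex})` and the charts `Spec Cᵢ`.** [folklore] -/
theorem preimage_puncturedSpace_sup_iSup (hb : IsBlowup b (vertexIdealSheaf d k)) :
    b ⁻¹ᵁ puncturedSpace d k ⊔ ⨆ i, (vertexChart hb i).opensRange = ⊤ := by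
  rw [iSup_opensRange_vertexChart, ← Scheme.Hom.preimage_sup, puncturedSpace_sup_lastChart,
    Scheme.Hom.preimage_top]

/-- Every point of `P̃` lies in `b⁻¹ D₊(x_j)` for some `j ≤ d` or in the image of some chart
`Spec Cᵢ`. [folklore] -/
theorem mem_preimage_basicOpen_or_mem_opensRange (hb : IsBlowup b (vertexIdealSheaf d k)) (x : P) :
    (∃ j : Fin (d + 1), b x ∈ Proj.basicOpen (grading (Fin (d + 1 + 1)) k) (MvPolynomial.X (Fin.castSucc j))) ∨
      ∃ i : Fin (d + 1), x ∈ (vertexChart hb i).opensRange := by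
  have hx : x ∈ (⊤ : P.Opens) := trivial
  rw [← preimage_puncturedSpace_sup_iSup hb, Opens.mem_sup, Opens.mem_iSup] at hx
  rcases hx with hx | hx
  · left
    have hx' : b x ∈ puncturedSpace d k := hx
    rw [puncturedSpace, Opens.mem_iSup] at hx'
    exact hx'
  · exact Or.inr hx

end Charts

end DeJong1996

end Literature.AlgebraicGeometry.Resolution

end
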